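import Mathlib
import Summits.NavierStokesRegularity.FluidComputer.AbcClassIIEigenpairOfComplexBases
import Summits.NavierStokesRegularity.FluidComputer.AbcClassIIComplexBasesAgreement

/-!
# GROUP-B, CLASS II — TWO 3-B-NESTED CERTIFICATES (TWO IMPLEMENTATIONS, TWO COMPLEX ORBIT-BASIS FAMILIES) CERTIFY
# THE SAME EIGENVALUE (profile-cert-3 g8, cell `ns-blowup`, 2026-08-27)
HONEST FRAMING (D-0035/D-0074): not a claim about Navier–Stokes blow-up. WHAT THIS IS NOT: not NS evidence;
MODEL lane (NS linearised about `abcFlow 1 1 1`, class II); no certificate, number or census word moves.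
**`same_eigenvalue_of_two_nested_certificates`** — the cell's AGREEMENT RULE (PLAN.md §1) as ONE kernel
implication: two 3-B-nested rows, each stated about the complex first-order matrix of ITS OWN complex orthonormal
orbit-basis family (`amc₁`, `amc₂`; hypotheses = `isLinNSEigenvalue_near_of_nested_certificate_of_complex_bases` ×2),
whose discs are close — `2M₁r₀₁ + 2M₂r₀₂ + ‖λ̃₁ − λ̃₂‖ < (1 − 2√2M₂²r₀₂)/M₂` (the printed `ρ₁ + ρ₂ + |λ̃₁ − λ̃₂| <
r_iso,2`) — yield ONE `λ⋆`, within `2M₁r₀₁` of `λ̃₁` AND `2M₂r₀₂` of `λ̃₂`, `Torus.IsLinNSEigenvalue`, isolated in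
BOTH coordinate systems, real if either trial value is real with `2ρ < r_iso`. Proof: the two general theorems,
then `eq_of_coord_eigenvector_of_isolated` (coordinates clause of certificate 1, isolation of certificate 2, unitary
transfers through instab4's `bfam`) with `norm_sub_lt_of_discs`. Mathlib + the files named; no new definitions.
bears_on LADDER-NS N5 / Z4-a(1) («CERTIFIED (two implementations)» as a kernel sentence modulo the row facts).
[folklore].
-/

noncomputable section

open scoped BigOperators ComplexConjugate InnerProductSpace
open Finset

namespace Summit.NavierStokesRegularity.FluidComputer.AbcClassIIEigenpair

open Literature.Analysis.FunctionSpaces Literature.Analysis.FunctionSpaces.Torus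
open Literature.Analysis.FunctionSpaces.EuclideanSpace
open Literature.Analysis.FluidPDE Literature.Analysis.FluidPDE.SteadyLattice
open Summit.NavierStokesRegularity.FluidComputer.AbcClassII

section TwoImplementations

variable (wf₁ : Idx → Fam)
variable (hws₁ : ∀ i : Idx, ∀ k ∉ i.1.1, wf₁ i k = 0)
variable (hwt₁ : ∀ (i : Idx) (k : Fin 3 → ℤ), ∑ j : Fin 3, ((k j : ℤ) : ℂ) * wf₁ i k j = 0)
variable (hwII₁ : ∀ i : Idx, IsClassII (wf₁ i))
variable (hwon₁ : ∀ (O : Orbit) (a b : Fin (odim O)),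
  ∑ k ∈ O.1, (inner ℂ (wf₁ ⟨O, a⟩ k) (wf₁ ⟨O, b⟩ k) : ℂ) = if a = b then 1 else 0)
variable (amc₁ : Idx → Idx → ℂ)
variable (hamc₁ : ∀ i j : Idx, amc₁ i j =
  ∑ k ∈ i.1.1, (inner ℂ (wf₁ i k) (Torus.lerayCoeff k (crossForm 1 1 1 (wf₁ j) k)) : ℂ))
variable (wf₂ : Idx → Fam)
variable (hws₂ : ∀ i : Idx, ∀ k ∉ i.1.1, wf₂ i k = 0)
variable (hwt₂ : ∀ (i : Idx) (k : Fin 3 → ℤ), ∑ j : Fin 3, ((k j : ℤ) : ℂ) * wf₂ i k j = 0)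
variable (hwII₂ : ∀ i : Idx, IsClassII (wf₂ i))
variable (hwon₂ : ∀ (O : Orbit) (a b : Fin (odim O)),
  ∑ k ∈ O.1, (inner ℂ (wf₂ ⟨O, a⟩ k) (wf₂ ⟨O, b⟩ k) : ℂ) = if a = b then 1 else 0)
variable (amc₂ : Idx → Idx → ℂ)
variable (hamc₂ : ∀ i j : Idx, amc₂ i j =
  ∑ k ∈ i.1.1, (inner ℂ (wf₂ i k) (Torus.lerayCoeff k (crossForm 1 1 1 (wf₂ j) k)) : ℂ))

include hws₁ hwt₁ hwII₁ hwon₁ hamc₁ hws₂ hwt₂ hwII₂ hwon₂ hamc₂ in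
/-- **Two 3-B-nested certificates in two complex orbit-basis families with close discs certify ONE eigenvalue.** -/
theorem same_eigenvalue_of_two_nested_certificates {R : ℝ} (hR : 1 ≤ R)
    -- certificate 1 (implementation 1, family `wf₁`)
    (K₁ Kv₁ : ℕ) (lt₁ : ℂ)
    (vt₁ : Idx → ℂ) (hvt0₁ : ∀ i, i ∉ cubeIdx Kv₁ → vt₁ i = 0)
    {r₀₁ nt₁ : ℝ} (hr₀₁ : 0 ≤ r₀₁) (hnt₁ : 0 ≤ nt₁)
    (hres₁ : ∑ i ∈ cubeIdx Kv₁ ∪ (cubeIdx Kv₁).biUnion nbrIdx,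
      ‖(if i ∈ cubeIdx Kv₁ then (lt₁ - ((-(onormSq i.1 / R) : ℝ) : ℂ)) * vt₁ i else 0) -
        ∑ j ∈ cubeIdx Kv₁, amc₁ i j * vt₁ j‖ ^ 2 ≤ r₀₁ ^ 2)
    (hntb₁ : ∑ i ∈ cubeIdx Kv₁ \ cubeIdx K₁, ‖vt₁ i‖ ^ 2 ≤ nt₁ ^ 2)
    (Binv₁ : ((↥(cubeIdx K₁) → ℂ) × ℂ) →ₗ[ℂ] ((↥(cubeIdx K₁) → ℂ) × ℂ))
    (hBinv₁ : ∀ (c : ↥(cubeIdx K₁) → ℂ) (m : ℂ),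
      Binv₁ (fun i : ↥(cubeIdx K₁) => (lt₁ - ((-(onormSq i.1.1 / R) : ℝ) : ℂ)) * c i -
          ∑ j : ↥(cubeIdx K₁), amc₁ i j * c j + m * vt₁ i,
        ∑ i : ↥(cubeIdx K₁), conj (vt₁ i) * c i) = (c, m))
    {α₁ βB₁ βC₁ gB₁ : ℝ} (hα₁ : 0 ≤ α₁) (hβB₁ : 0 ≤ βB₁) (hβC₁ : 0 ≤ βC₁) (hgB₁ : 0 ≤ gB₁)
    (hαM₁ : ∀ (c : ↥(cubeIdx K₁) → ℂ) (g : ℂ),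
      ∑ j : ↥(cubeIdx K₁), ‖(Binv₁ (c, g)).1 j‖ ^ 2 + ‖(Binv₁ (c, g)).2‖ ^ 2 ≤
        α₁ ^ 2 * (∑ i : ↥(cubeIdx K₁), ‖c i‖ ^ 2 + ‖g‖ ^ 2))
    (hβBM₁ : ∀ e : Idx → ℂ,
      ∑ j : ↥(cubeIdx K₁), ‖(Binv₁ (fun i : ↥(cubeIdx K₁) => -∑ j ∈ nbrIdx i \ cubeIdx K₁,
          amc₁ i j * e j, 0)).1 j‖ ^ 2 +
        ‖(Binv₁ (fun i : ↥(cubeIdx K₁) => -∑ j ∈ nbrIdx i \ cubeIdx K₁,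
          amc₁ i j * e j, 0)).2‖ ^ 2 ≤
        βB₁ ^ 2 * ∑ j ∈ (cubeIdx K₁).biUnion nbrIdx \ cubeIdx K₁, ‖e j‖ ^ 2)
    (hβCM₁ : ∀ (c : ↥(cubeIdx K₁) → ℂ) (g : ℂ),
      ∑ i ∈ ((cubeIdx K₁).biUnion nbrIdx ∪ cubeIdx Kv₁) \ cubeIdx K₁,
        ‖-∑ j : ↥(cubeIdx K₁), amc₁ i j * (Binv₁ (c, g)).1 j +
          (Binv₁ (c, g)).2 * vt₁ i‖ ^ 2 ≤ βC₁ ^ 2 * (∑ i : ↥(cubeIdx K₁), ‖c i‖ ^ 2 + ‖g‖ ^ 2))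
    (hgBM₁ : ∀ e : Idx → ℂ,
      ‖(Binv₁ (fun i : ↥(cubeIdx K₁) => ∑ j ∈ nbrIdx i \ cubeIdx K₁,
          amc₁ i j * e j, 0)).2‖ ^ 2 ≤
        gB₁ ^ 2 * ∑ j ∈ (cubeIdx K₁).biUnion nbrIdx \ cubeIdx K₁, ‖e j‖ ^ 2)
    {MU2₁ μ₁ M₁ : ℝ}
    (hshellM₁ : ∀ e : Idx → ℂ, (∀ i ∈ cubeIdx K₁, e i = 0) →
      MU2₁ * ∑ i ∈ cubeIdx (K₁ + 1) \ cubeIdx K₁, ‖e i‖ ^ 2 ≤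
        ∑ i ∈ cubeIdx (K₁ + 1) \ cubeIdx K₁, (lt₁.re - (-(onormSq i.1 / R)) - Real.sqrt 2) * ‖e i‖ ^ 2 -
        RCLike.re (∑ i ∈ (cubeIdx K₁).biUnion nbrIdx \ cubeIdx K₁,
          conj (∑ j : ↥(cubeIdx K₁), amc₁ i j *
            (Binv₁ (fun i : ↥(cubeIdx K₁) => ∑ j ∈ nbrIdx i \ cubeIdx K₁,
              amc₁ i j * e j, 0)).1 j) * e i))
    (htailK₁ : MU2₁ ≤ lt₁.re + ((K₁ : ℝ) + 2) ^ 2 / R - Real.sqrt 2)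
    (hμdef₁ : μ₁ = MU2₁ - gB₁ * nt₁) (hμ₁ : 0 < μ₁)
    (hMdef₁ : M₁ = √((1 + βC₁ ^ 2) / μ₁ ^ 2 + (α₁ + βB₁ * √(1 + βC₁ ^ 2) / μ₁) ^ 2))
    (hκ₁ : 2 * Real.sqrt 2 * M₁ ^ 2 * r₀₁ < 1)
    -- certificate 2 (implementation 2, family `wf₂`)
    (K₂ Kv₂ : ℕ) (lt₂ : ℂ)
    (vt₂ : Idx → ℂ) (hvt0₂ : ∀ i, i ∉ cubeIdx Kv₂ → vt₂ i = 0)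
    {r₀₂ nt₂ : ℝ} (hr₀₂ : 0 ≤ r₀₂) (hnt₂ : 0 ≤ nt₂)
    (hres₂ : ∑ i ∈ cubeIdx Kv₂ ∪ (cubeIdx Kv₂).biUnion nbrIdx,
      ‖(if i ∈ cubeIdx Kv₂ then (lt₂ - ((-(onormSq i.1 / R) : ℝ) : ℂ)) * vt₂ i else 0) -
        ∑ j ∈ cubeIdx Kv₂, amc₂ i j * vt₂ j‖ ^ 2 ≤ r₀₂ ^ 2)
    (hntb₂ : ∑ i ∈ cubeIdx Kv₂ \ cubeIdx K₂, ‖vt₂ i‖ ^ 2 ≤ nt₂ ^ 2)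
    (Binv₂ : ((↥(cubeIdx K₂) → ℂ) × ℂ) →ₗ[ℂ] ((↥(cubeIdx K₂) → ℂ) × ℂ))
    (hBinv₂ : ∀ (c : ↥(cubeIdx K₂) → ℂ) (m : ℂ),
      Binv₂ (fun i : ↥(cubeIdx K₂) => (lt₂ - ((-(onormSq i.1.1 / R) : ℝ) : ℂ)) * c i -
          ∑ j : ↥(cubeIdx K₂), amc₂ i j * c j + m * vt₂ i,
        ∑ i : ↥(cubeIdx K₂), conj (vt₂ i) * c i) = (c, m))
    {α₂ βB₂ βC₂ gB₂ : ℝ} (hα₂ : 0 ≤ α₂) (hβB₂ : 0 ≤ βB₂) (hβC₂ : 0 ≤ βC₂) (hgB₂ : 0 ≤ gB₂)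
    (hαM₂ : ∀ (c : ↥(cubeIdx K₂) → ℂ) (g : ℂ),
      ∑ j : ↥(cubeIdx K₂), ‖(Binv₂ (c, g)).1 j‖ ^ 2 + ‖(Binv₂ (c, g)).2‖ ^ 2 ≤
        α₂ ^ 2 * (∑ i : ↥(cubeIdx K₂), ‖c i‖ ^ 2 + ‖g‖ ^ 2))
    (hβBM₂ : ∀ e : Idx → ℂ,
      ∑ j : ↥(cubeIdx K₂), ‖(Binv₂ (fun i : ↥(cubeIdx K₂) => -∑ j ∈ nbrIdx i \ cubeIdx K₂,
          amc₂ i j * e j, 0)).1 j‖ ^ 2 +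
        ‖(Binv₂ (fun i : ↥(cubeIdx K₂) => -∑ j ∈ nbrIdx i \ cubeIdx K₂,
          amc₂ i j * e j, 0)).2‖ ^ 2 ≤
        βB₂ ^ 2 * ∑ j ∈ (cubeIdx K₂).biUnion nbrIdx \ cubeIdx K₂, ‖e j‖ ^ 2)
    (hβCM₂ : ∀ (c : ↥(cubeIdx K₂) → ℂ) (g : ℂ),
      ∑ i ∈ ((cubeIdx K₂).biUnion nbrIdx ∪ cubeIdx Kv₂) \ cubeIdx K₂,
        ‖-∑ j : ↥(cubeIdx K₂), amc₂ i j * (Binv₂ (c, g)).1 j +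
          (Binv₂ (c, g)).2 * vt₂ i‖ ^ 2 ≤ βC₂ ^ 2 * (∑ i : ↥(cubeIdx K₂), ‖c i‖ ^ 2 + ‖g‖ ^ 2))
    (hgBM₂ : ∀ e : Idx → ℂ,
      ‖(Binv₂ (fun i : ↥(cubeIdx K₂) => ∑ j ∈ nbrIdx i \ cubeIdx K₂,
          amc₂ i j * e j, 0)).2‖ ^ 2 ≤
        gB₂ ^ 2 * ∑ j ∈ (cubeIdx K₂).biUnion nbrIdx \ cubeIdx K₂, ‖e j‖ ^ 2)
    {MU2₂ μ₂ M₂ : ℝ}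
    (hshellM₂ : ∀ e : Idx → ℂ, (∀ i ∈ cubeIdx K₂, e i = 0) →
      MU2₂ * ∑ i ∈ cubeIdx (K₂ + 1) \ cubeIdx K₂, ‖e i‖ ^ 2 ≤
        ∑ i ∈ cubeIdx (K₂ + 1) \ cubeIdx K₂, (lt₂.re - (-(onormSq i.1 / R)) - Real.sqrt 2) * ‖e i‖ ^ 2 -
        RCLike.re (∑ i ∈ (cubeIdx K₂).biUnion nbrIdx \ cubeIdx K₂,
          conj (∑ j : ↥(cubeIdx K₂), amc₂ i j *
            (Binv₂ (fun i : ↥(cubeIdx K₂) => ∑ j ∈ nbrIdx i \ cubeIdx K₂,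
              amc₂ i j * e j, 0)).1 j) * e i))
    (htailK₂ : MU2₂ ≤ lt₂.re + ((K₂ : ℝ) + 2) ^ 2 / R - Real.sqrt 2)
    (hμdef₂ : μ₂ = MU2₂ - gB₂ * nt₂) (hμ₂ : 0 < μ₂)
    (hMdef₂ : M₂ = √((1 + βC₂ ^ 2) / μ₂ ^ 2 + (α₂ + βB₂ * √(1 + βC₂ ^ 2) / μ₂) ^ 2))
    (hκ₂ : 2 * Real.sqrt 2 * M₂ ^ 2 * r₀₂ < 1)
    -- the discs are close: `ρ₁ + ρ₂ + |λ̃₁ − λ̃₂| < r_iso,2`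
    (hnear : 2 * M₁ * r₀₁ + 2 * M₂ * r₀₂ + ‖lt₁ - lt₂‖ < (1 - 2 * Real.sqrt 2 * M₂ ^ 2 * r₀₂) / M₂) :
    ∃ lam : ℂ, ‖lam - lt₁‖ ≤ 2 * M₁ * r₀₁ ∧ ‖lam - lt₂‖ ≤ 2 * M₂ * r₀₂ ∧
      Torus.IsLinNSEigenvalue (1 / (2 * Real.pi * R)) (Torus.abcFlow 1 1 1) (2 * Real.pi * lam) ∧
      (∀ z : ℂ, z ≠ lam → ‖z - lam‖ < (1 - 2 * Real.sqrt 2 * M₁ ^ 2 * r₀₁) / M₁ →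
        ∀ w : Idx → ℂ, (Summable fun i : Idx => (1 + onormSq i.1 / R) ^ 2 * ‖w i‖ ^ 2) →
          (∀ i : Idx, ((-(onormSq i.1 / R) : ℝ) : ℂ) * w i +
            ∑ j ∈ nbrIdx i, amc₁ i j * w j = z * w i) → w = 0) ∧
      (∀ z : ℂ, z ≠ lam → ‖z - lam‖ < (1 - 2 * Real.sqrt 2 * M₂ ^ 2 * r₀₂) / M₂ →
        ∀ w : Idx → ℂ, (Summable fun i : Idx => (1 + onormSq i.1 / R) ^ 2 * ‖w i‖ ^ 2) →
          (∀ i : Idx, ((-(onormSq i.1 / R) : ℝ) : ℂ) * w i +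
            ∑ j ∈ nbrIdx i, amc₂ i j * w j = z * w i) → w = 0) ∧
      (lt₁.im = 0 → 2 * (2 * M₁ * r₀₁) < (1 - 2 * Real.sqrt 2 * M₁ ^ 2 * r₀₁) / M₁ → lam.im = 0) ∧
      (lt₂.im = 0 → 2 * (2 * M₂ * r₀₂) < (1 - 2 * Real.sqrt 2 * M₂ ^ 2 * r₀₂) / M₂ → lam.im = 0) := by
  obtain ⟨lam₁, hclose₁, heig₁, hisol₁, hreal₁, hcoord₁⟩ :=
    isLinNSEigenvalue_near_of_nested_certificate_of_complex_bases wf₁ hws₁ hwt₁ hwII₁ hwon₁ amc₁ hamc₁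
      hR K₁ Kv₁ lt₁ vt₁ hvt0₁ hr₀₁ hnt₁ hres₁ hntb₁ Binv₁ hBinv₁ hα₁ hβB₁ hβC₁ hgB₁ hαM₁ hβBM₁ hβCM₁ hgBM₁ hshellM₁ htailK₁ hμdef₁ hμ₁ hMdef₁ hκ₁
  obtain ⟨lam₂, hclose₂, -, hisol₂, hreal₂, -⟩ :=
    isLinNSEigenvalue_near_of_nested_certificate_of_complex_bases wf₂ hws₂ hwt₂ hwII₂ hwon₂ amc₂ hamc₂
      hR K₂ Kv₂ lt₂ vt₂ hvt0₂ hr₀₂ hnt₂ hres₂ hntb₂ Binv₂ hBinv₂ hα₂ hβB₂ hβC₂ hgB₂ hαM₂ hβBM₂ hβCM₂ hgBM₂ hshellM₂ htailK₂ hμdef₂ hμ₂ hMdef₂ hκ₂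
  have hdist : ‖lam₁ - lam₂‖ < (1 - 2 * Real.sqrt 2 * M₂ ^ 2 * r₀₂) / M₂ :=
    norm_sub_lt_of_discs hclose₁ hclose₂ hnear
  have heq : lam₁ = lam₂ :=
    eq_of_coord_eigenvector_of_isolated wf₁ hws₁ hwt₁ hwII₁ hwon₁ amc₁ hamc₁ wf₂ hws₂ hwt₂ hwII₂ hwon₂ amc₂
      hamc₂ hR lam₁ lam₂ hcoord₁ hisol₂ hdist
  subst heq
  exact ⟨lam₁, hclose₁, hclose₂, heig₁, hisol₁, hisol₂, hreal₁, hreal₂⟩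

end TwoImplementations

end Summit.NavierStokesRegularity.FluidComputer.AbcClassIIEigenpair

end
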